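import Summits.QuantumAdvantage.QuantumAdvantage.Theorems.CubicForrelationNearExactIsExactTwelveLevelSix5964

/-!
# Crux `CubicForrelation.NearExactIsExact` (stmt-QuantumAdvantage-14043) — n = 12: the value `59/64` is NOT attained;
  `Φ ≥ 59/64 ⇒ Φ = 1` (closed), `θ₁₂ ∈ [57/64, 59/64)`

Certificate seat `b2b-cforr-cert` (gen 15).  HONEST FRAMING: a kernel-checked DECIDABLE VERDICT (standard axioms, no `decide`/`native_decide`)
about the finite slice `n = 12` of the crux — NOT summit progress (the crux asks for ONE `θ < 1` uniform in `n`; nothing here is uniform).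

The tree had the open-ended isolation `Φ > 59/64 ⇒ Φ = 1` (`isolation_twelve_5964`, gen 14) and the record `57/64`, i.e.
`θ₁₂ ∈ [57/64, 59/64]`, and asked whether `59/64` is attained.  It is not:
* a TYPE-O side (`W_g/16` odd somewhere) is impossible at `Φ ≥ 59/64` (`to15_typeO_ge_false`, gen 15);
* a LEVEL-5 side (`W_g/32` odd somewhere) is impossible at `Φ ≥ 59/64` (`tw15_levelFive_ge_false`, gen 15);
* a LEVEL-`≥ 6` side (`W_g ∈ 64ℤ`) is impossible at `Φ = 59/64` (`tw15_levelSix_5964_false`, gen 15);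
and every cubic `g` on 12 bits is of one of these three kinds (`W_g ∈ 16ℤ` by Ax/McEliece, `tw_base`).  Hence `Φ(f,g) ≠ 59/64`, the CLOSED
isolation `Φ ≥ 59/64 ⇒ Φ = 1` (`isolation_twelve_ge_5964`), and `θ₁₂ < 59/64` (`theta_twelve_halfopen_5964`; with the record:
`θ₁₂ ∈ [57/64, 59/64)`).  The 31 candidate values `913/1024, …, 943/1024` remain undecided.

References: J. Ax (1964) / R. J. McEliece (1972); T. Kasami, N. Tokura (1970); MacWilliams–Sloane (1977) Ch. 13–15; C. Carlet (2021) §5.2;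
R. O'Donnell (2014) §3.3.  Everything below is proved from Mathlib and the tree; axioms are the standard three.
-/

set_option linter.dupNamespace false -- D-0017: single-problem summit ⇒ `QuantumAdvantage.QuantumAdvantage` by design

noncomputable section

namespace Summit.QuantumAdvantage.QuantumAdvantage.Theorems.CubicForrelation.NearExactIsExact

open Finset
open Literature.Computability.QuantumComplexity
open Literature.Computability.QuantumComplexity.DerivativeWalsh (W)

/-! ### `59/64` is not a value -/

/-- **No cubic pair on `6 + 6` bits has `Φ = 59/64`** (the three kinds of `g` — type O, level 5, level `≥ 6` — are each excluded).
NOT summit progress. [this work] -/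
theorem tw15_value_5964_false (f g : (Fin (6 + 6) → Bool) → Bool) (hf : IsDegLeFun 3 f) (hg : IsDegLeFun 3 g)
    (hΦ : forrelation f g = 59 / 64) : False := by
  obtain ⟨u, hu⟩ := tw_base (n := 6 + 6) g hg 4 (by norm_num)
  by_cases hO : ∃ x, Odd (u x)
  · exact to15_typeO_ge_false f g hf hg u hu hO (by rw [hΦ])
  push Not at hO
  have hu' : ∀ x, W (fun y => signOf (g y)) x = (2 : ℝ) ^ 5 * (((u x / 2 : ℤ)) : ℝ) := fun x => by
    rw [tw_level_up g u hu hO x]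
  by_cases h5 : ∃ x, Odd (u x / 2)
  · exact tw15_levelFive_ge_false f g hf hg (fun x => u x / 2) hu' h5 (by rw [hΦ])
  push Not at h5
  have hu'' : ∀ x, W (fun y => signOf (g y)) x = (2 : ℝ) ^ 6 * (((u x / 2 / 2 : ℤ)) : ℝ) := fun x => by
    rw [tw_level_up (j := 5) g (fun x => u x / 2) hu' h5 x]
  exact tw15_levelSix_5964_false f g hf hg (fun x => u x / 2 / 2) hu'' hΦ

/-- **Closed isolation at `59/64` on `6 + 6` bits**: `Φ ≥ 59/64 ⇒ Φ = 1` for cubic pairs. NOT summit progress. [this work] -/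
theorem tw15_isolation_ge_5964 (f g : (Fin (6 + 6) → Bool) → Bool) (hf : IsDegLeFun 3 f) (hg : IsDegLeFun 3 g)
    (hΦ : (59 / 64 : ℝ) ≤ forrelation f g) : forrelation f g = 1 := by
  rcases hΦ.lt_or_eq with hlt | heq
  · exact tw_isolation_5964 f g hf hg hlt
  · exact (tw15_value_5964_false f g hf hg heq.symm).elim

/-! ### Packaging at the literal type `Fin 12` -/

/-- **On 12 bits, `Φ ≥ 59/64 ⇒ Φ = 1`** for all cubic `f, g : 𝔽₂¹² → 𝔽₂` — the CLOSED second-window isolation (the tree had the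
open-ended `isolation_twelve_5964`).  A kernel-checked verdict about the finite slice `n = 12`; NOT summit progress. [this work] -/
theorem isolation_twelve_ge_5964 : ∀ f g : (Fin 12 → Bool) → Bool, IsDegLeFun 3 f → IsDegLeFun 3 g →
    (59 / 64 : ℝ) ≤ forrelation f g → forrelation f g = 1 :=
  fun f g hf hg h => tw15_isolation_ge_5964 f g hf hg h

/-- **`59/64` is not a forrelation value of a cubic pair on 12 bits.** NOT summit progress. [this work] -/
theorem no_value_twelve_5964 : ¬ ∃ f g : (Fin 12 → Bool) → Bool, IsDegLeFun 3 f ∧ IsDegLeFun 3 g ∧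
    forrelation f g = 59 / 64 := by
  rintro ⟨f, g, hf, hg, h⟩
  exact tw15_value_5964_false f g hf hg h

/-- **`θ₁₂ < 59/64`**, indeed `θ₁₂ ∈ [57/64, 59/64)`: the least isolation threshold for cubic pairs on 12 bits is at least the record `57/64`
(`theta_twelve_bounds`) and STRICTLY below `59/64` (closed isolation + `fb_theta_lt_of_closed`).  The tree had `θ₁₂ ≤ 59/64`
(`theta_twelve_closed_5964`).  NOT summit progress. [this work] -/
theorem theta_twelve_halfopen_5964 : ∃ θ₀ : ℝ, 57 / 64 ≤ θ₀ ∧ θ₀ < 59 / 64 ∧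
    IsLeast {θ : ℝ | ∀ f g : (Fin 12 → Bool) → Bool, IsDegLeFun 3 f → IsDegLeFun 3 g →
      θ < forrelation f g → forrelation f g = 1} θ₀ := by
  obtain ⟨θ₀, hθ₀⟩ := theta_exists 12
  obtain ⟨θ, hθlt, hθ⟩ := fb_theta_lt_of_closed (n := 12) (59 / 64) isolation_twelve_ge_5964
  exact ⟨θ₀, theta_twelve_bounds.2 θ₀ hθ₀.1, lt_of_le_of_lt (hθ₀.2 hθ) hθlt, hθ₀⟩

/-- **No cubic pair on 12 bits has `Φ ∈ [59/64, 1)`.** NOT summit progress. [this work] -/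
theorem no_window_twelve_ge_5964 : ¬ ∃ f g : (Fin 12 → Bool) → Bool, IsDegLeFun 3 f ∧ IsDegLeFun 3 g ∧
    (59 / 64 : ℝ) ≤ forrelation f g ∧ forrelation f g < 1 := by
  rintro ⟨f, g, hf, hg, hle, hlt⟩
  have h := isolation_twelve_ge_5964 f g hf hg hle
  linarith

end Summit.QuantumAdvantage.QuantumAdvantage.Theorems.CubicForrelation.NearExactIsExact

end
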